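import Mathlib.Tactic.Linarith
import Summits.CriticalPhenomena.PercolationContinuityZ3.Theorems.PercNearOneGluingNoHeavyLowerTailSahiCTCAllLiveCOne
import HarnessLib

/-!
# `NoHeavyLowerTail` (crux stmt-CriticalPhenomena-4575), P3 lane: weighted LYM for DOWN-sets (simplicial complexes), profile-wise and as the
# polynomial block `e_j·GF(K_c) − e_c·GF(K_j) ∈ ℕ[r]` (c ≤ j), and the general Z-face bracket of `PARA₂`

Support file (seat `prim-l12-p3`, gen 18; `--supports stmt-CriticalPhenomena-4575`).  Companions `…SahiCTCWeightedLYM` (up-sets), `…SahiCTCGenFun`,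
`…SahiCTCPara2Moves`.  Memo g9 §7.3 (the LYM block `LYM[F; I<J] = e_J|F_I| − e_I|F_J|` of the step certificates, `F` a down-set) and g17 §1.4.
* `card_level_powerset` : the cube `[D, N]` has `C(#N − #D, k − #D)` members of size `k`;
* `card_level_down_ge` : for a down-set `K`, `D ⊆ N`, `c ≤ j`, `c + j = #N + #D`: `#{S ∈ K : D ⊆ S ⊆ N, #S = j} ≤ #{… #S = c}` (complement of the
  up-set statement inside the cube);
* `downLYM_pairs`, `coeff_downLYM(_sub_nonneg)` : the profile-pair and polynomial forms: `e_j·GF(K_c) − e_c·GF(K_j)` has nonnegative coefficients;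
* `coeff_Zface_bracket_nonneg_of_isLowerSet` : for ANY down-set `K_X` (dead points allowed) the Z-face bracket `D₁·X_{≤1} − Θ₁·X_{≥2}` of
  `…SahiCTCPara2Moves.para2_erase_Zface` has nonnegative coefficients (it is `Σ_{j≥2} [(e_j K_0 − e_0 K_j) + (e_j K_1 − e_1 K_j)]`).
Nothing is asserted about the crux.
-/

namespace Summit.CriticalPhenomena.PercolationContinuityZ3.Theorems.SahiCTCWeightedLYM

open Finset

variable {α : Type*} [DecidableEq α]

/-- The full cube `[D, N]` has `C(#N − #D, k − #D)` members of size `k ≥ #D`. [folklore] -/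
theorem card_level_powerset {D N : Finset α} (hDN : D ⊆ N) {k : ℕ} (hk : #D ≤ k) :
    #(level N.powerset D N k) = (#N - #D).choose (k - #D) := by
  rw [← card_sdiff_of_subset hDN, ← card_powersetCard]
  refine (card_bij (fun T _ => D ∪ T) (fun T hT => ?_) (fun T hT T' hT' h => ?_) (fun S hS => ?_)).symm
  · obtain ⟨hT, hTk⟩ := mem_powersetCard.1 hT
    have hTsub : T ⊆ N \ D := hT
    have hdisj : Disjoint D T := disjoint_left.2 fun x hxD hxT => (mem_sdiff.1 (hTsub hxT)).2 hxD
    refine mem_level.2 ⟨mem_powerset.2 ?_, subset_union_left, ?_, ?_⟩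
    · exact union_subset hDN (hTsub.trans sdiff_subset)
    · exact union_subset hDN (hTsub.trans sdiff_subset)
    · rw [card_union_of_disjoint hdisj, hTk]; omega
  · have hT1 : T ⊆ N \ D := (mem_powersetCard.1 hT).1
    have hT2 : T' ⊆ N \ D := (mem_powersetCard.1 hT').1
    ext x; constructor
    · intro hx
      have hxD : x ∉ D := (mem_sdiff.1 (hT1 hx)).2
      have : x ∈ D ∪ T' := h ▸ mem_union_right D hx
      rcases mem_union.1 this with h' | h'
      · exact absurd h' hxD
      · exact h'
    · intro hx
      have hxD : x ∉ D := (mem_sdiff.1 (hT2 hx)).2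
      have : x ∈ D ∪ T := h.symm ▸ mem_union_right D hx
      rcases mem_union.1 this with h' | h'
      · exact absurd h' hxD
      · exact h'
  · obtain ⟨_, hDS, hSN, hSk⟩ := mem_level.1 hS
    refine ⟨S \ D, mem_powersetCard.2 ⟨sdiff_subset_sdiff hSN Subset.rfl, ?_⟩, ?_⟩
    · rw [card_sdiff_of_subset hDS, hSk]
    · exact union_sdiff_of_subset hDS

/-- **LYM for a down-set at complementary levels of a cube**: for a down-set `K`, `D ⊆ N`, `c ≤ j`, `c + j = #N + #D`, level `j` of `K` in `[D, N]` is
at most level `c` (apply the up-set statement to the complement `N.powerset ∖ K`, which is upward closed inside `N`, and use that complementary levels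
of the cube are equinumerous). [folklore] -/
theorem card_level_down_ge {K : Finset (Finset α)} (hK : IsLowerSet (K : Set (Finset α))) {D N : Finset α} (hDN : D ⊆ N) {c j : ℕ}
    (hcj : c ≤ j) (hsum : c + j = #N + #D) : #(level K D N j) ≤ #(level K D N c) := by
  have hDcard : #D ≤ #N := card_le_card hDN
  by_cases hc : #D ≤ c
  swap
  · -- then `j > #N` and level `j` is empty
    have : level K D N j = ∅ := by
      refine filter_eq_empty_iff.2 fun S _ h => ?_
      have := card_le_card h.2.1; omega
    rw [this, card_empty]; exact Nat.zero_le _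
  set U : Finset (Finset α) := N.powerset \ K with hU
  have hUup : ∀ ⦃A B : Finset α⦄, A ∈ U → A ⊆ B → B ⊆ N → B ∈ U := by
    intro A B hA hAB hBN
    rw [hU, mem_sdiff] at hA ⊢
    exact ⟨mem_powerset.2 hBN, fun hB => hA.2 (hK hAB hB)⟩
  -- levels of `K` and `U` partition the levels of the cube
  have split : ∀ k, #(level K D N k) + #(level U D N k) = #(level N.powerset D N k) := by
    intro k
    rw [← card_union_of_disjoint]
    · congr 1; ext S
      simp only [mem_union, mem_level, hU, mem_sdiff, mem_powerset]
      constructor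
      · rintro (⟨hS, h1, h2, h3⟩ | ⟨⟨_, _⟩, h1, h2, h3⟩) <;> exact ⟨h2, h1, h2, h3⟩
      · rintro ⟨_, h1, h2, h3⟩
        by_cases hSK : S ∈ K
        · exact Or.inl ⟨hSK, h1, h2, h3⟩
        · exact Or.inr ⟨⟨h2, hSK⟩, h1, h2, h3⟩
    · rw [disjoint_left]; intro S h1 h2
      rw [mem_level] at h1 h2; rw [hU, mem_sdiff] at h2; exact h2.1.2 h1.1
  have hUlym := card_level_le_card_level hUup hDN hcj hsum
  have hNc := card_level_powerset hDN hc
  have hNj := card_level_powerset hDN (hc.trans hcj)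
  have heq : (#N - #D).choose (c - #D) = (#N - #D).choose (j - #D) := by
    rw [show j - #D = (#N - #D) - (c - #D) by omega]; exact (Nat.choose_symm (by omega)).symm
  have hc' := split c; have hj' := split j
  rw [hNc] at hc'; rw [hNj, ← heq] at hj'
  omega

/-- **Weighted LYM for down-sets, coefficientwise** (pairs form): for a down-set `K` and `c ≤ j`, at every profile the number of pairs `(P, S)` with
`#P = c`, `S ∈ K`, `#S = j` is at most the number with `#P = j`, `S ∈ K`, `#S = c`. [this work] -/
theorem downLYM_pairs {K : Finset (Finset α)} (hK : IsLowerSet (K : Set (Finset α))) (D N : Finset α) {c j : ℕ} (hcj : c ≤ j) :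
    #(pairs K D N (· = c) (· = j)) ≤ #(pairs K D N (· = j) (· = c)) := by
  rcases (pairs K D N (· = c) (· = j)).eq_empty_or_nonempty with h0 | hne
  · rw [h0]; exact Nat.zero_le _
  have hDN : D ⊆ N := subset_of_pairs_nonempty hne
  obtain ⟨PS, hPS⟩ := hne
  obtain ⟨_, hI, hUn, hP, hS⟩ := mem_pairs.1 hPS
  have hsum : c + j = #N + #D := by rw [← hP, ← hS]; exact card_add_card_of_inter_union hI hUn
  rw [card_pairs_eq_card_level hDN hsum, card_pairs_eq_card_level hDN (by omega : j + c = #N + #D)]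
  exact card_level_down_ge hK hDN hcj hsum

end Summit.CriticalPhenomena.PercolationContinuityZ3.Theorems.SahiCTCWeightedLYM

namespace Summit.CriticalPhenomena.PercolationContinuityZ3.Theorems.SahiCTCForms

open Finset MvPolynomial SahiCTCGenFun SahiCTCWeightedLYM

variable {α : Type*} [DecidableEq α] [Fintype α]

/-- **The LYM block for down-sets as a polynomial inequality** (g9 §7.3 `LYM[F; I<J]`): for a down-set `K` and `c ≤ j`, every coefficient of
`e_c·GF(K_j)` is at most the corresponding coefficient of `e_j·GF(K_c)`. [this work] -/
theorem coeff_downLYM {K : Finset (Finset α)} (hK : IsLowerSet (K : Set (Finset α))) {c j : ℕ} (hcj : c ≤ j) (n : α →₀ ℕ) :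
    (gf (univ.powerset.filter fun P => #P = c) * gf (K.filter fun S => #S = j)).coeff n ≤
      (gf (univ.powerset.filter fun P => #P = j) * gf (K.filter fun S => #S = c)).coeff n := by
  rw [coeff_gf_mul_gf, coeff_gf_mul_gf]
  by_cases hn : ∀ i, n i ≤ 2
  · rw [filter_prod_eq_pairs K (· = c) (· = j) n hn, filter_prod_eq_pairs K (· = j) (· = c) n hn]
    exact_mod_cast downLYM_pairs hK (dbl n) n.support hcj
  · rw [filter_prod_eq_empty _ _ n hn, filter_prod_eq_empty _ _ n hn]

/-- `e_j·GF(K_c) − e_c·GF(K_j) ∈ ℕ[r]` for a down-set `K`, `c ≤ j`. [this work] -/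
theorem coeff_downLYM_sub_nonneg {K : Finset (Finset α)} (hK : IsLowerSet (K : Set (Finset α))) {c j : ℕ} (hcj : c ≤ j) (n : α →₀ ℕ) :
    0 ≤ (gf (univ.powerset.filter fun P => #P = j) * gf (K.filter fun S => #S = c) -
      gf (univ.powerset.filter fun P => #P = c) * gf (K.filter fun S => #S = j)).coeff n := by
  rw [coeff_sub, sub_nonneg]; exact coeff_downLYM hK hcj n

/-! ### The general Z-face bracket of `PARA₂` -/

omit [DecidableEq α] in
/-- A family graded by size: `GF(F) = Σ_{k ≤ card α} GF(F_k)`. [this work] -/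
theorem gf_eq_sum_levels [DecidableEq α] (F : Finset (Finset α)) :
    gf F = ∑ k ∈ range (Fintype.card α + 1), gf (F.filter fun S => #S = k) := by
  unfold gf
  rw [← sum_biUnion]
  · congr 1; ext S
    simp only [mem_biUnion, mem_range, mem_filter]
    constructor
    · intro h; exact ⟨#S, Nat.lt_succ_of_le (card_le_univ S), h, rfl⟩
    · rintro ⟨k, _, h, _⟩; exact h
  · intro k _ l _ hkl
    exact disjoint_left.2 fun S h1 h2 => hkl ((mem_filter.1 h1).2.symm.trans (mem_filter.1 h2).2)

/-- **The Z-face bracket of `PARA₂` is coefficientwise nonnegative for EVERY down-set `K_X`** (dead points allowed):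
`D₁·X_{≤1} − Θ₁·X_{≥2} = Σ_{j ≥ 2} [(e_j·K_0 − e_0·K_j) + (e_j·K_1 − e_1·K_j)]`, each bracket `≥ 0` by `coeff_downLYM`. [this work] -/
theorem coeff_Zface_bracket_nonneg_of_isLowerSet {KX : Finset (Finset α)} (hK : IsLowerSet (KX : Set (Finset α))) (n : α →₀ ℕ) :
    0 ≤ (D1 * gf (faces1 KX) - Th1 * gf (faces2up KX) : MvPolynomial α ℤ).coeff n := by
  -- graded pieces
  set R := range (Fintype.card α + 1) with hR
  set E : ℕ → MvPolynomial α ℤ := fun k => gf (univ.powerset.filter fun P : Finset α => #P = k) with hE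
  set Kk : ℕ → MvPolynomial α ℤ := fun k => gf (KX.filter fun S => #S = k) with hKk
  have hD1 : (D1 : MvPolynomial α ℤ) = ∑ k ∈ R.filter (fun k => 2 ≤ k), E k := by
    unfold D1 bySize
    rw [gf_eq_sum_levels, ← sum_filter_add_sum_filter_not R (fun k => 2 ≤ k)]
    rw [show (∑ k ∈ R.filter (fun k => ¬ 2 ≤ k), gf ((univ.powerset.filter fun S : Finset α => 2 ≤ #S).filter fun S => #S = k)) = 0 from
      sum_eq_zero fun k hk => by
        have hk2 := (mem_filter.1 hk).2
        have : ((univ.powerset.filter fun S : Finset α => 2 ≤ #S).filter fun S => #S = k) = ∅ :=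
          filter_eq_empty_iff.2 fun S hS h => hk2 (h ▸ (mem_filter.1 hS).2)
        rw [this]; unfold gf; simp]
    rw [add_zero]
    refine sum_congr rfl fun k hk => ?_
    have hk2 := (mem_filter.1 hk).2
    congr 1; ext S; simp only [mem_filter]
    constructor
    · rintro ⟨⟨h1, _⟩, h3⟩; exact ⟨h1, h3⟩
    · rintro ⟨h1, h3⟩; exact ⟨⟨h1, h3 ▸ hk2⟩, h3⟩
  have hTh1 : (Th1 : MvPolynomial α ℤ) = E 0 + E 1 := by
    unfold Th1 bySize
    have hU : (univ.powerset.filter fun S : Finset α => #S ≤ 1) = (univ.powerset.filter fun S : Finset α => #S = 0) ∪ (univ.powerset.filter fun S : Finset α => #S = 1) := by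
      ext S; simp only [mem_filter, mem_union]; constructor
      · rintro ⟨h, h'⟩; rcases Nat.lt_or_ge #S 1 with h1 | h1
        · exact Or.inl ⟨h, by omega⟩
        · exact Or.inr ⟨h, by omega⟩
      · rintro (⟨h, h'⟩ | ⟨h, h'⟩) <;> exact ⟨h, by omega⟩
    have hdj : Disjoint (univ.powerset.filter fun S : Finset α => #S = 0) (univ.powerset.filter fun S : Finset α => #S = 1) := by
      rw [disjoint_left]; intro S h1 h2; simp only [mem_filter] at h1 h2; omega
    rw [hU, gf_union hdj]
  have hX1 : gf (faces1 KX) = Kk 0 + Kk 1 := by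
    have hU : faces1 KX = (KX.filter fun S => #S = 0) ∪ (KX.filter fun S => #S = 1) := by
      ext S; simp only [faces1, mem_filter, mem_union, mem_powerset]; constructor
      · rintro ⟨_, h, hK⟩; rcases Nat.lt_or_ge #S 1 with h1 | h1
        · exact Or.inl ⟨hK, by omega⟩
        · exact Or.inr ⟨hK, by omega⟩
      · rintro (⟨hK, h⟩ | ⟨hK, h⟩) <;> exact ⟨subset_univ _, by omega, hK⟩
    have hdj : Disjoint (KX.filter fun S => #S = 0) (KX.filter fun S => #S = 1) := by
      rw [disjoint_left]; intro S h1 h2; simp only [mem_filter] at h1 h2; omega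
    rw [hU, gf_union hdj]
  have hX2 : gf (faces2up KX) = ∑ k ∈ R.filter (fun k => 2 ≤ k), Kk k := by
    unfold faces2up
    rw [gf_eq_sum_levels, ← sum_filter_add_sum_filter_not R (fun k => 2 ≤ k)]
    rw [show (∑ k ∈ R.filter (fun k => ¬ 2 ≤ k), gf ((univ.powerset.filter fun S : Finset α => 2 ≤ #S ∧ S ∈ KX).filter fun S => #S = k)) = 0 from
      sum_eq_zero fun k hk => by
        have hk2 := (mem_filter.1 hk).2
        have : ((univ.powerset.filter fun S : Finset α => 2 ≤ #S ∧ S ∈ KX).filter fun S => #S = k) = ∅ :=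
          filter_eq_empty_iff.2 fun S hS h => hk2 (h ▸ (mem_filter.1 hS).2.1)
        rw [this]; unfold gf; simp]
    rw [add_zero]
    refine sum_congr rfl fun k hk => ?_
    have hk2 := (mem_filter.1 hk).2
    congr 1; ext S; simp only [mem_filter, mem_powerset]
    constructor
    · rintro ⟨⟨_, _, hK⟩, h3⟩; exact ⟨hK, h3⟩
    · rintro ⟨hK, h3⟩; exact ⟨⟨subset_univ _, h3 ▸ hk2, hK⟩, h3⟩
  -- the bracket as a sum of down-LYM differences
  have key : (D1 * gf (faces1 KX) - Th1 * gf (faces2up KX) : MvPolynomial α ℤ) =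
      ∑ k ∈ R.filter (fun k => 2 ≤ k), ((E k * Kk 0 - E 0 * Kk k) + (E k * Kk 1 - E 1 * Kk k)) := by
    rw [hD1, hTh1, hX1, hX2, sum_mul, mul_sum, ← sum_sub_distrib]
    refine sum_congr rfl fun k _ => ?_
    ring
  rw [key, coeff_sum]
  refine sum_nonneg fun k hk => ?_
  have hk2 := (mem_filter.1 hk).2
  rw [coeff_add]
  have h0 := coeff_downLYM_sub_nonneg hK (show 0 ≤ k by omega) n
  have h1 := coeff_downLYM_sub_nonneg hK (show 1 ≤ k by omega) n
  simp only [hE, hKk] at h0 h1 ⊢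
  linarith

end Summit.CriticalPhenomena.PercolationContinuityZ3.Theorems.SahiCTCForms
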